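/-
Copyright (c) 2026. All rights reserved.
Released under Apache 2.0 license as described in the file LICENSE.
Authors: abc-iut cell — seat abc-iut-w4-d104 (wave 4, D-0067 cone-interior discharge; node
AbsTopIII:Prop2.6). Proof-only, Mathlib-only, no definitions.
-/
import Mathlib.Analysis.InnerProductSpace.Basic
import Mathlib.LinearAlgebra.Complex.Determinant
import Mathlib.Topology.Instances.RealVectorSpace
import Mathlib.Topology.Algebra.Group.Basic
import HarnessLib

/-!
# Rigidity lemmas behind [AbsTopIII] Prop 2.6: local additivity, right angles, orientation

S. Mochizuki, *Topics in absolute anabelian geometry III*, Prop. 2.6 (kurims pp. 57–58, bib key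
`MochizukiAbsTopIII2015`) asserts that the group `𝒜_p` of germs of local automorphisms at `p ∈ U ⊆ ℂ`
that are "compatible with the local additive structures" (Prop. 2.5 (e): `a +_p b`, the parallelogram
sum relative to the origin `p`, defined for `a, b` near `p`) and "preserve the orthogonal frames and
orientations" is `ℂ^×`, via its tautological action — "immediate from the elementary content of the
characterizations".  This file supplies that elementary content as three Mathlib-only lemmas:

* `exists_clm_eqOn_of_locallyAdditive` — a self-map `g` of `ℂ`, continuous at `0`, that is additive
  on a ball around `0` WHENEVER the sum stays in the ball (`g (a + b) = g a + g b` for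
  `‖a‖, ‖b‖, ‖a + b‖ < r`) agrees on that ball with a (unique) continuous `ℝ`-linear map
  (extension by `ℕ`-division, Cauchy's functional equation with continuity);
* `det_eq_of_clm` — the real determinant of `L : ℂ →L[ℝ] ℂ` is
  `re (L 1) · im (L i) − im (L 1) · re (L i)`;
* `exists_eq_mul_of_orthogonal_of_det_pos` — an `ℝ`-linear `L : ℂ → ℂ` that maps orthogonal pairs
  to orthogonal pairs and has positive determinant is multiplication by a nonzero complex number
  (and conversely `inner_mul_left_mul_left`, `det_mulLeft`).

No new definitions; nothing here bears on the disputed [IUTchIII] Cor. 3.12.  The germ-level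
statements (the group `𝒜_p`, `ℂ^× ≃ₜ* 𝒜_p`, the `LocalLinearHolStructure` instance) are in
`HolomorphicCoresLocalLinearProofs.lean` over `LocalHomeomorphismGerms.lean`.
-/

noncomputable section

namespace Literature.AnabelianGeometry.AbsoluteAnabelian

open Filter Complex
open scoped Topology InnerProductSpace ComplexConjugate

/-! ### Local additivity near `0` forces linearity -/

section LocallyAdditive

variable {g : ℂ → ℂ} {r : ℝ}

/-- A locally additive map vanishes at the origin. (Auxiliary.)
[cite: MochizukiAbsTopIII2015, Proposition 2.6 (proof) pp.57–58] -/
theorem map_zero_of_locallyAdditive (hr : 0 < r)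
    (hadd : ∀ a b : ℂ, ‖a‖ < r → ‖b‖ < r → ‖a + b‖ < r → g (a + b) = g a + g b) : g 0 = 0 := by
  have h := hadd 0 0 (by simpa using hr) (by simpa using hr) (by simpa using hr)
  simp only [add_zero] at h
  linear_combination -h

/-- A locally additive map is `ℕ`-homogeneous as long as all the multiples stay in the ball.
(Auxiliary.) [cite: MochizukiAbsTopIII2015, Proposition 2.6 (proof) pp.57–58] -/
theorem map_natCast_mul_of_locallyAdditive (hr : 0 < r)
    (hadd : ∀ a b : ℂ, ‖a‖ < r → ‖b‖ < r → ‖a + b‖ < r → g (a + b) = g a + g b) :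
    ∀ (k : ℕ) (x : ℂ), (k : ℝ) * ‖x‖ < r → g ((k : ℂ) * x) = (k : ℂ) * g x
  | 0, x, _ => by simp [map_zero_of_locallyAdditive hr hadd]
  | (k + 1), x, hk => by
    have hx0 : 0 ≤ ‖x‖ := norm_nonneg x
    have hk' : (k : ℝ) * ‖x‖ < r := by
      have : (k : ℝ) * ‖x‖ ≤ ((k + 1 : ℕ) : ℝ) * ‖x‖ := by
        gcongr
        exact_mod_cast Nat.le_succ k
      exact lt_of_le_of_lt this hk
    have hx : ‖x‖ < r := by
      have : ‖x‖ ≤ ((k + 1 : ℕ) : ℝ) * ‖x‖ := by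
        have h1 : (1 : ℝ) ≤ ((k + 1 : ℕ) : ℝ) := by exact_mod_cast Nat.succ_pos k
        nlinarith
      exact lt_of_le_of_lt this hk
    have ih := map_natCast_mul_of_locallyAdditive hr hadd k x hk'
    have h1 : ‖(k : ℂ) * x‖ < r := by rwa [norm_mul, Complex.norm_natCast]
    have h2 : ‖(k : ℂ) * x + x‖ < r := by
      have : (k : ℂ) * x + x = ((k + 1 : ℕ) : ℂ) * x := by push_cast; ring
      rwa [this, norm_mul, Complex.norm_natCast]
    calc g (((k + 1 : ℕ) : ℂ) * x) = g ((k : ℂ) * x + x) := by congr 1; push_cast; ring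
      _ = g ((k : ℂ) * x) + g x := hadd _ _ h1 hx h2
      _ = ((k + 1 : ℕ) : ℂ) * g x := by rw [ih]; push_cast; ring

/-- The canonical denominator: `‖x‖ < r · N x` with `N x = ⌊‖x‖ / r⌋ + 1`. (Auxiliary.)
[cite: MochizukiAbsTopIII2015, Proposition 2.6 (proof) pp.57–58] -/
theorem norm_lt_mul_floor_succ (hr : 0 < r) (x : ℂ) :
    ‖x‖ < r * ((⌊‖x‖ / r⌋₊ + 1 : ℕ) : ℝ) := by
  have h := Nat.lt_floor_add_one (‖x‖ / r)
  rw [div_lt_iff₀ hr] at h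
  push_cast
  linarith [h]

/-- Well-definedness of the extension: for every admissible denominator `n` (`‖x‖ < r n`) the value
`n · g (x / n)` is the same. (Auxiliary.) [cite: MochizukiAbsTopIII2015, Proposition 2.6 (proof) pp.57–58] -/
theorem natCast_mul_map_div_eq_of_locallyAdditive (hr : 0 < r)
    (hadd : ∀ a b : ℂ, ‖a‖ < r → ‖b‖ < r → ‖a + b‖ < r → g (a + b) = g a + g b)
    {x : ℂ} {n m : ℕ} (hn : 0 < n) (hm : 0 < m) (hxn : ‖x‖ < r * n) (hxm : ‖x‖ < r * m) :
    (n : ℂ) * g (x / n) = (m : ℂ) * g (x / m) := by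
  have hn' : (n : ℂ) ≠ 0 := by exact_mod_cast hn.ne'
  have hm' : (m : ℂ) ≠ 0 := by exact_mod_cast hm.ne'
  have hnR : (0 : ℝ) < n := by exact_mod_cast hn
  have hmR : (0 : ℝ) < m := by exact_mod_cast hm
  set y : ℂ := x / ((n : ℂ) * m) with hy
  have hny : ‖y‖ = ‖x‖ / ((n : ℝ) * m) := by
    rw [hy, norm_div, norm_mul, Complex.norm_natCast, Complex.norm_natCast]
  have hxn' : x / n = (m : ℂ) * y := by rw [hy]; field_simp
  have hxm' : x / m = (n : ℂ) * y := by rw [hy]; field_simp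
  have h1 : (m : ℝ) * ‖y‖ < r := by
    rw [hny]
    have : (m : ℝ) * (‖x‖ / ((n : ℝ) * m)) = ‖x‖ / n := by field_simp
    rw [this, div_lt_iff₀ hnR]
    linarith
  have h2 : (n : ℝ) * ‖y‖ < r := by
    rw [hny]
    have : (n : ℝ) * (‖x‖ / ((n : ℝ) * m)) = ‖x‖ / m := by field_simp
    rw [this, div_lt_iff₀ hmR]
    linarith
  rw [hxn', hxm', map_natCast_mul_of_locallyAdditive hr hadd m y h1,
    map_natCast_mul_of_locallyAdditive hr hadd n y h2]
  ring

/-- **Local additivity forces linearity.** A self-map `g` of `ℂ` which is continuous at `0` and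
additive on the ball of radius `r` around `0` whenever the sum stays in the ball agrees on that
ball with a continuous `ℝ`-linear map.  (The printed "compatible with the local additive structures
[of Prop. 2.5 (e)]" for a germ of homeomorphism at `p`, after translating `p` to `0`.) (Auxiliary.)
[cite: MochizukiAbsTopIII2015, Proposition 2.6 (proof) pp.57–58] -/
theorem exists_clm_eqOn_of_locallyAdditive (hr : 0 < r)
    (hadd : ∀ a b : ℂ, ‖a‖ < r → ‖b‖ < r → ‖a + b‖ < r → g (a + b) = g a + g b)
    (hg : ContinuousAt g 0) : ∃ L : ℂ →L[ℝ] ℂ, ∀ x : ℂ, ‖x‖ < r → g x = L x := by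
  classical
  -- the extension
  let N : ℂ → ℕ := fun x => ⌊‖x‖ / r⌋₊ + 1
  have hN : ∀ x, ‖x‖ < r * (N x : ℝ) := fun x => by
    simpa [N] using norm_lt_mul_floor_succ hr x
  have hNpos : ∀ x, 0 < N x := fun x => Nat.succ_pos _
  let G : ℂ → ℂ := fun x => (N x : ℂ) * g (x / N x)
  -- any admissible denominator computes `G`
  have hG : ∀ (x : ℂ) (n : ℕ), 0 < n → ‖x‖ < r * n → G x = (n : ℂ) * g (x / n) := fun x n hn hxn =>
    natCast_mul_map_div_eq_of_locallyAdditive hr hadd (hNpos x) hn (hN x) hxn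
  -- `G = g` on the ball
  have hGg : ∀ x, ‖x‖ < r → G x = g x := fun x hx => by
    rw [hG x 1 one_pos (by simpa using hx)]
    simp
  -- `G` is additive
  have hGadd : ∀ x y, G (x + y) = G x + G y := by
    intro x y
    set n : ℕ := N x + N y + N (x + y) with hn
    have hnpos : 0 < n := by positivity
    have hnR : (0 : ℝ) < n := by exact_mod_cast hnpos
    have hle : ∀ {k : ℕ}, k ≤ n → ∀ {z : ℂ}, ‖z‖ < r * k → ‖z‖ < r * n := by
      intro k hk z hz
      exact lt_of_lt_of_le hz (mul_le_mul_of_nonneg_left (by exact_mod_cast hk) hr.le)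
    have hx : ‖x‖ < r * n := hle (by omega) (hN x)
    have hy : ‖y‖ < r * n := hle (by omega) (hN y)
    have hxy : ‖x + y‖ < r * n := hle (by omega) (hN (x + y))
    have hn' : (n : ℂ) ≠ 0 := by exact_mod_cast hnpos.ne'
    have hdiv : ∀ {z : ℂ}, ‖z‖ < r * n → ‖z / n‖ < r := by
      intro z hz
      rw [norm_div, Complex.norm_natCast, div_lt_iff₀ hnR]
      linarith
    rw [hG (x + y) n hnpos hxy, hG x n hnpos hx, hG y n hnpos hy, ← mul_add, add_div]
    congr 1
    refine hadd _ _ (hdiv hx) (hdiv hy) ?_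
    rw [← add_div]
    exact hdiv hxy
  -- bundle and use continuity at `0`
  let Gh : ℂ →+ ℂ := AddMonoidHom.mk' G hGadd
  have hG0 : ContinuousAt Gh 0 := by
    have heq : g =ᶠ[𝓝 0] Gh := by
      filter_upwards [Metric.ball_mem_nhds (0 : ℂ) hr] with x hx
      rw [Metric.mem_ball, dist_zero_right] at hx
      exact (hGg x hx).symm
    exact hg.congr heq
  have hGc : Continuous Gh := continuous_of_continuousAt_zero Gh hG0
  refine ⟨Gh.toRealLinearMap hGc, fun x hx => ?_⟩
  rw [AddMonoidHom.coe_toRealLinearMap]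
  exact (hGg x hx).symm

end LocallyAdditive

/-! ### Right angles and orientation force complex-linearity -/

section Conformal

/-- The real determinant of a continuous `ℝ`-linear self-map of `ℂ`, in the basis `(1, i)`.
(Auxiliary.) [cite: MochizukiAbsTopIII2015, Proposition 2.6 (proof) pp.57–58] -/
theorem det_eq_of_clm (L : ℂ →L[ℝ] ℂ) :
    LinearMap.det (L : ℂ →ₗ[ℝ] ℂ) = (L 1).re * (L I).im - (L 1).im * (L I).re := by
  rw [← LinearMap.det_toMatrix Complex.basisOneI, Matrix.det_fin_two]
  simp [LinearMap.toMatrix_apply, Complex.coe_basisOneI_repr, Complex.coe_basisOneI]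
  ring

/-- An `ℝ`-linear self-map of `ℂ` in coordinates: `L z = re z · L 1 + im z · L i`. (Auxiliary.)
[cite: MochizukiAbsTopIII2015, Proposition 2.6 (proof) pp.57–58] -/
theorem clm_apply_eq (L : ℂ →L[ℝ] ℂ) (z : ℂ) : L z = (z.re : ℝ) • L 1 + (z.im : ℝ) • L I := by
  have hz : z = (z.re : ℝ) • (1 : ℂ) + (z.im : ℝ) • I := by
    rw [Complex.real_smul, Complex.real_smul, mul_one, Complex.re_add_im]
  conv_lhs => rw [hz]
  rw [map_add, map_smul, map_smul]

/-- Multiplication by `c` scales real inner products by `|c|²`; in particular it maps orthogonal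
pairs to orthogonal pairs. (Auxiliary.) [cite: MochizukiAbsTopIII2015, Proposition 2.6 (proof) pp.57–58] -/
theorem inner_mul_left_mul_left (c u v : ℂ) : ⟪c * u, c * v⟫_ℝ = Complex.normSq c * ⟪u, v⟫_ℝ := by
  rw [Complex.inner, Complex.inner, map_mul]
  have : c * v * ((starRingEnd ℂ) c * (starRingEnd ℂ) u) =
      (c * (starRingEnd ℂ) c) * (v * (starRingEnd ℂ) u) := by ring
  rw [this, Complex.mul_conj, Complex.re_ofReal_mul]

/-- The determinant of multiplication by `c` (as an `ℝ`-linear map) is `|c|²`. (Auxiliary.)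
[cite: MochizukiAbsTopIII2015, Proposition 2.6 (proof) pp.57–58] -/
theorem det_mulLeft (c : ℂ) :
    LinearMap.det ((c • ContinuousLinearMap.id ℝ ℂ : ℂ →L[ℝ] ℂ) : ℂ →ₗ[ℝ] ℂ) = Complex.normSq c := by
  rw [det_eq_of_clm]
  simp [Complex.normSq_apply]

/-- **Right angles + orientation force complex-linearity.** A continuous `ℝ`-linear self-map of `ℂ`
that maps orthogonal pairs of vectors to orthogonal pairs ("preserves orthogonal frames",
Rmk. 2.5.1) and has positive determinant ("preserves orientations", Prop. 2.5 (d)) is multiplication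
by a nonzero complex number. (Auxiliary.) [cite: MochizukiAbsTopIII2015, Proposition 2.6 (proof) pp.57–58] -/
theorem exists_eq_mul_of_orthogonal_of_det_pos (L : ℂ →L[ℝ] ℂ)
    (horth : ∀ u v : ℂ, ⟪u, v⟫_ℝ = 0 → ⟪L u, L v⟫_ℝ = 0)
    (hdet : 0 < LinearMap.det (L : ℂ →ₗ[ℝ] ℂ)) :
    ∃ c : ℂ, c ≠ 0 ∧ ∀ z, L z = c * z := by
  set a := L 1 with ha
  set b := L I with hb
  -- the two test pairs `1 ⊥ i` and `1 + i ⊥ 1 - i`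
  have h1 : ⟪(1 : ℂ), I⟫_ℝ = 0 := by simp [Complex.inner]
  have h2 : ⟪(1 : ℂ) + I, 1 - I⟫_ℝ = 0 := by
    simp [Complex.inner]
  have hab : ⟪a, b⟫_ℝ = 0 := horth _ _ h1
  have hab' : ⟪a + b, a - b⟫_ℝ = 0 := by
    have := horth _ _ h2
    rwa [map_add, map_sub] at this
  rw [Complex.inner] at hab hab'
  -- in coordinates
  have e1 : b.re * a.re + b.im * a.im = 0 := by
    simpa [Complex.mul_re, Complex.conj_re, Complex.conj_im] using hab
  have e2 : a.re ^ 2 + a.im ^ 2 = b.re ^ 2 + b.im ^ 2 := by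
    have h := hab'
    simp [Complex.mul_re, Complex.conj_re, Complex.conj_im] at h
    nlinarith [h]
  have e3 : 0 < a.re * b.im - a.im * b.re := by rwa [det_eq_of_clm] at hdet
  -- Lagrange's identity pins the determinant to the common norm
  have hN : 0 < a.re ^ 2 + a.im ^ 2 := by nlinarith [sq_nonneg (a.re * b.im - a.im * b.re)]
  have hlag : (a.re * b.im - a.im * b.re) ^ 2 + (b.re * a.re + b.im * a.im) ^ 2 =
      (a.re ^ 2 + a.im ^ 2) * (b.re ^ 2 + b.im ^ 2) := by ring
  rw [e1, ← e2] at hlag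
  have hDN : a.re * b.im - a.im * b.re = a.re ^ 2 + a.im ^ 2 := by
    have h := (sq_eq_sq₀ e3.le hN.le).1
    apply h
    nlinarith [hlag]
  have hbre : b.re = -a.im := by
    nlinarith [sq_nonneg (b.re + a.im), sq_nonneg (b.im - a.re)]
  have hbim : b.im = a.re := by
    nlinarith [sq_nonneg (b.re + a.im), sq_nonneg (b.im - a.re)]
  refine ⟨a, ?_, fun z => ?_⟩
  · intro h0
    rw [h0] at hN
    simp at hN
  · rw [clm_apply_eq L z, ← ha, ← hb]
    apply Complex.ext
    · simp [Complex.mul_re, hbre]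
      ring
    · simp [Complex.mul_im, hbim]
      ring

end Conformal

end Literature.AnabelianGeometry.AbsoluteAnabelian

end
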